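import Literature.Probability.RandomPlanarGeometry.SLERestrictionLemmas
import Literature.Probability.RandomPlanarGeometry.SLEKappaRhoRestriction
import Literature.Probability.RandomPlanarGeometry.CritPercSLESimplePathProofs
import Literature.Probability.RandomPlanarGeometry.SLEBoundaryHittingProofs
import HarnessLib

/-!
# The restriction martingale of SLE_{8/3} along the HULL hitting time, and its transport to the trace

G. F. Lawler, O. Schramm, W. Werner, *Conformal restriction: the chordal case*, J. Amer. Math.
Soc. **16** (2003) 917–955, arXiv:math/0209343 (**[LSW]**), §5 (Prop. 5.2, Prop. 5.3) and the
proof of Thm. 6.1 (§6).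

The named fact `Literature.Probability.RandomPlanarGeometry.sle_exists_isRestrictionMartingale`
(`SLERestrictionMartingale`) packages [LSW] Prop. 5.2/5.3 at `κ = 8/3` — "`Y_t = h_t'(W_t)^{5/8}`,
`t < T`, is a bounded martingale" — together with the first sentence of the proof of Thm. 6.1
("the a.s. limit `Y_T := lim_{t ↗ T} Y_t` exists"), with the time `T` read as the first hitting
time of `A` by the SLE_{8/3} TRACE (`firstHit (sleTrace (8/3) ω) A`). In [LSW] §5 the time is
`T = T_A = inf{t : K_t ∩ A ≠ ∅}`, the hitting time of `A` by the (closed) Loewner HULLS, a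
functional of the driving function alone (no trace is needed to state or prove Prop. 5.3); the
two agree almost surely because the SLE_{8/3} trace exists and is a simple curve generating the
hulls (Rohde–Schramm (2005), Thms. 5.1 and 6.1; [LSW] p. 15: "we know [RS] that SLE_{8/3} is a
simple curve"). This file separates the two:

* `Literature.Probability.RandomPlanarGeometry.IsHullRestrictionMartingale A Y` — the
  specification of the restriction martingale of the hull `A` EXACTLY as in [LSW] §5, i.e. the
  structure `IsRestrictionMartingale` of `SLERestrictionMartingale` with the hull hitting time
  `Loewner.hullHitTime (sleDriving (8/3) ω) A` (`SLEKappaRhoRestriction`) in place of the trace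
  hitting time (non-vacuity: `isHullRestrictionMartingale_empty`);
* `Literature.Probability.RandomPlanarGeometry.Loewner.IsHullHitTime.hullHitTime_eq` — a finite
  hull hitting time in the sense of the predicate `Loewner.IsHullHitTime` (`SLERestrictionLemmas`)
  is the value of `Loewner.hullHitTime` (PROVED);
* `Literature.Probability.RandomPlanarGeometry.ae_hullHitTime_eq_firstHit` — PROVED: **if
  SLE_{8/3} is generated by a curve (`HasSLETrace (8/3)`, RS05 Thm. 5.1), then almost surely the
  hull hitting time of every closed `A ∌ 0` is the first hitting time of `A` by the trace** (the
  trace is then a.s. simple, `ae_isSimpleTrace_sleTrace_of_hasSLETrace` = RS05 Thm. 6.1 proved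
  in the tree from trace existence, its closed hulls are `γ(0, t] ∪ {0}`,
  `closedHull_subset_image`, and real points of `A` are never swallowed,
  `sle_swallowingTime_ofReal_eq_firstHit_holds`);
* `Literature.Probability.RandomPlanarGeometry.IsHullRestrictionMartingale.isRestrictionMartingale`
  and `Literature.Probability.RandomPlanarGeometry.sle_exists_isRestrictionMartingale_of_hull` —
  PROVED: hence a hull restriction martingale is a restriction martingale in the sense of
  `SLERestrictionMartingale`, and **`sle_exists_isRestrictionMartingale` follows from its
  hull-time form together with `HasSLETrace (8/3)`** — the latter being in any case an input of
  every consumer of the fact in the tree (`SLERestrictionLocal`, `HullRestrictionSLELeaf`).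

The hull-time form itself ([LSW] Prop. 5.3 proper) is the object of the Itô-free
conditional-increment proof built on `StarHullOneStepClean` (one-step expansion of
`Φ'_B(0)^{5/8}` with vanishing drift at `κ = 8/3`) and
`Literature.Probability.Process.NestedStoppedMartingales` (terminal limits); it is NOT asserted
here as a named fact.

## References

* [LSW] §5 p. 12 ("let `T = T_A = inf{t : K_t ∩ A ≠ ∅}`"), Prop. 5.2, Prop. 5.3 (p. 13), proof of
  Thm. 6.1 (p. 15, "`T = sup{t : γ[0,t] ∩ A = ∅}`"). [LawlerSchrammWerner2003Restriction]
* S. Rohde, O. Schramm, *Basic properties of SLE*, Ann. of Math. 161 (2005), Thm. 5.1, Thm. 6.1.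
  [RohdeSchramm2005]
-/

noncomputable section

open Set Filter Topology MeasureTheory Metric
open UpperHalfPlane (upperHalfPlaneSet)
open scoped NNReal

namespace Literature.Probability.RandomPlanarGeometry

/-! ### Finite hull hitting times -/

namespace Loewner

variable {W : ℝ≥0 → ℝ} {A : Set ℂ}

/-- A hull hitting time in the sense of `IsHullHitTime` (the closed hulls miss `A` strictly
before `τ` and meet it strictly after) is the value of `hullHitTime` (an infimum over a final
segment of times). [folklore] -/
theorem IsHullHitTime.hullHitTime_eq {τ : ℝ≥0} (h : IsHullHitTime W A τ) : hullHitTime W A = τ := by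
  refine le_antisymm ?_ ?_
  · by_contra hlt
    push Not at hlt
    obtain ⟨s, hτs, hsT⟩ := exists_between hlt
    have hs : s ≠ ⊤ := ne_top_of_lt hsT
    obtain ⟨s', rfl⟩ := WithTop.ne_top_iff_exists.1 hs
    exact h.2 s' (by exact_mod_cast hτs) (disjoint_closedHull_of_lt_hullHitTime hsT)
  · by_contra hlt
    push Not at hlt
    obtain ⟨t, htτ, hnd⟩ := exists_not_disjoint_of_hullHitTime_lt hlt
    exact hnd (h.1 t (by exact_mod_cast htτ))

end Loewner

/-! ### The specification along the hull hitting time -/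

/-- **Specification of the restriction martingale `Y` of SLE_{8/3} for the hull `A`, along the
HULL hitting time** ([LSW] §5, Prop. 5.2–5.3, and the first sentence of the proof of Thm. 6.1):
the structure `IsRestrictionMartingale` of `SLERestrictionMartingale` verbatim, except that the
random time is `T = T_A = inf{t : K_t ∩ A ≠ ∅}` (`Loewner.hullHitTime` of the SLE_{8/3} driving
function `√(8/3) B`), as printed in [LSW] §5, instead of the first hitting time of `A` by the
trace: a real process `Y` on `(ℝ≥0 → ℝ, preWienerMeasure)` with `0 ≤ Y ≤ 1`, an
`𝓕ᵂ`-martingale, a.s. equal to `Φ'_{A_t − W_t}(0)^{5/8} = h_t'(W_t)^{5/8}` before `T` (with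
`0 < Φ'_{A_t − W_t}(0) ≤ 1`, [LSW] (2.4)), frozen at its left limit from `T` on, and convergent at
`∞` on `{T = ∞}`. [cite: LawlerSchrammWerner2003Restriction, §5 (T_A), Prop. 5.2, Prop. 5.3 and proof of Thm. 6.1] -/
structure IsHullRestrictionMartingale (A : Set ℂ) (Y : ℝ≥0 → (ℝ≥0 → ℝ) → ℝ) : Prop where
  /-- `0 ≤ Y_t ≤ 1`. -/
  mem_Icc : ∀ t ω, Y t ω ∈ Icc (0 : ℝ) 1
  /-- `Y` is an `𝓕ᵂ`-martingale under the pre-Wiener measure. -/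
  martingale : Martingale Y brownianFiltration Process.preWienerMeasure
  /-- A.s., before the hull hitting time of `A`, `Y_t = Φ'_{A_t − W_t}(0)^{5/8}` with
  `0 < Φ'_{A_t − W_t}(0) ≤ 1`. -/
  ae_exists_eq_rpow : ∀ᵐ ω ∂Process.preWienerMeasure, ∀ t : ℝ≥0,
    (t : WithTop ℝ≥0) < Loewner.hullHitTime (sleDriving ((8 : ℝ≥0) / 3) ω) A →
      ∃ (Ψ : ConformalEquiv
          (upperHalfPlaneSet \ Loewner.slidHull (sleDriving ((8 : ℝ≥0) / 3) ω) A t)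
          upperHalfPlaneSet) (e : ℝ),
        IsRestrictionMap (Loewner.slidHull (sleDriving ((8 : ℝ≥0) / 3) ω) A t) Ψ ∧
          HasRestrictionDeriv (Loewner.slidHull (sleDriving ((8 : ℝ≥0) / 3) ω) A t) Ψ e ∧
          0 < e ∧ e ≤ 1 ∧ Y t ω = e ^ ((5 : ℝ) / 8)
  /-- A.s., from the hull hitting time `T < ∞` on, `Y` equals its left limit at `T`. -/
  ae_frozen : ∀ᵐ ω ∂Process.preWienerMeasure, ∀ τ : ℝ≥0,
    Loewner.hullHitTime (sleDriving ((8 : ℝ≥0) / 3) ω) A = τ →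
      ∀ t : ℝ≥0, τ ≤ t → Tendsto (fun s ↦ Y s ω) (𝓝[<] τ) (𝓝 (Y t ω))
  /-- A.s., if `A` is never hit by the closed hulls (`T = ∞`), `lim_{t → ∞} Y_t` exists. -/
  ae_exists_tendsto : ∀ᵐ ω ∂Process.preWienerMeasure,
    Loewner.hullHitTime (sleDriving ((8 : ℝ≥0) / 3) ω) A = ⊤ →
      ∃ c : ℝ, Tendsto (fun t ↦ Y t ω) atTop (𝓝 c)

/-- **Non-vacuity**: the constant process `1` is a hull restriction martingale for the empty hull
(`T = ∞`, `A_t − W_t = ∅`, `Φ_∅ = id`, `Φ'_∅(0) = 1`). [folklore] -/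
theorem isHullRestrictionMartingale_empty : IsHullRestrictionMartingale ∅ fun _ _ ↦ 1 := by
  haveI : Fact Process.isProjectiveLimit_preWienerMeasure := ⟨isProjectiveLimit_preWienerMeasure_holds⟩
  exact
  { mem_Icc := fun _ _ ↦ ⟨zero_le_one, le_rfl⟩
    martingale := martingale_const _ _ _
    ae_exists_eq_rpow := Eventually.of_forall fun ω t _ ↦
      exists_isRestrictionMap_of_eq_empty (Loewner.slidHull_empty _ _)
    ae_frozen := Eventually.of_forall fun ω τ hτ ↦ by
      rw [Loewner.hullHitTime_eq_top_iff.2 fun t ↦ Set.disjoint_empty _] at hτ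
      exact absurd hτ WithTop.top_ne_coe
    ae_exists_tendsto := Eventually.of_forall fun _ _ ↦ ⟨1, tendsto_const_nhds⟩ }

/-! ### Transport to the trace hitting time under `HasSLETrace (8/3)` -/

/-- **Hull hitting time = trace hitting time, almost surely, given trace existence.** If the
SLE_{8/3} chain is a.s. generated by a curve (`HasSLETrace (8/3)`, Rohde–Schramm Thm. 5.1), then
for every closed `A ∌ 0`, almost surely `inf{t : K_t ∩ A ≠ ∅} = inf{t : γ(t) ∈ A}`: the trace
is a.s. simple (RS05 Thm. 6.1, `ae_isSimpleTrace_sleTrace_of_hasSLETrace`), so `K_t ⊆ γ[0, t]`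
(`closedHull_subset_image`) misses `A` before the trace hits it, and `γ(T) ∈ K_s ∩ A` for `s > T`
(`isHullHitTime_of_firstHit_eq`). [cite: RohdeSchramm2005, Thm 5.1 and Thm 6.1] -/
theorem ae_hullHitTime_eq_firstHit (hT : HasSLETrace ((8 : ℝ≥0) / 3)) {A : Set ℂ} (hA : IsClosed A)
    (h0 : (0 : ℂ) ∉ A) :
    ∀ᵐ ω ∂Process.preWienerMeasure,
      Loewner.hullHitTime (sleDriving ((8 : ℝ≥0) / 3) ω) A = firstHit (sleTrace ((8 : ℝ≥0) / 3) ω) A := by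
  filter_upwards [hT, ae_isSimpleTrace_sleTrace_of_hasSLETrace hT (by
    rw [div_le_iff₀ (by norm_num : (0 : ℝ≥0) < 3)]; norm_num)] with ω hgen' hs
  have hgen : Loewner.IsGeneratedByCurve (sleDriving ((8 : ℝ≥0) / 3) ω) (sleTrace ((8 : ℝ≥0) / 3) ω) :=
    Loewner.isGeneratedByCurve_trace hgen'
  rcases eq_or_ne (firstHit (sleTrace ((8 : ℝ≥0) / 3) ω) A) ⊤ with h | h
  · rw [h, Loewner.hullHitTime_eq_top_iff]
    exact disjoint_closedHull sle_swallowingTime_ofReal_eq_firstHit_holds hgen hs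
      (firstHit_eq_top_iff_disjoint.1 h)
  · obtain ⟨τ, hτ⟩ := WithTop.ne_top_iff_exists.1 h
    rw [← hτ]
    exact (isHullHitTime_of_firstHit_eq sle_swallowingTime_ofReal_eq_firstHit_holds hgen hs hA h0
      hτ.symm).hullHitTime_eq

variable {A : Set ℂ} {Y : ℝ≥0 → (ℝ≥0 → ℝ) → ℝ}

/-- **A hull restriction martingale is a restriction martingale** (for the trace hitting time,
`IsRestrictionMartingale` of `SLERestrictionMartingale`), given `HasSLETrace (8/3)`: the two
random times agree almost surely (`ae_hullHitTime_eq_firstHit`).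
[cite: LawlerSchrammWerner2003Restriction, Prop. 5.3 and proof of Thm. 6.1] -/
theorem IsHullRestrictionMartingale.isRestrictionMartingale (hT : HasSLETrace ((8 : ℝ≥0) / 3))
    (hA : IsClosed A) (h0 : (0 : ℂ) ∉ A) (hY : IsHullRestrictionMartingale A Y) :
    IsRestrictionMartingale A Y where
  mem_Icc := hY.mem_Icc
  martingale := hY.martingale
  ae_exists_eq_rpow := by
    filter_upwards [hY.ae_exists_eq_rpow, ae_hullHitTime_eq_firstHit hT hA h0] with ω hω heq t ht
    exact hω t (heq ▸ ht)
  ae_frozen := by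
    filter_upwards [hY.ae_frozen, ae_hullHitTime_eq_firstHit hT hA h0] with ω hω heq τ hτ
    exact hω τ (heq ▸ hτ)
  ae_exists_tendsto := by
    filter_upwards [hY.ae_exists_tendsto, ae_hullHitTime_eq_firstHit hT hA h0] with ω hω heq hτ
    exact hω (heq ▸ hτ)

/-- **`sle_exists_isRestrictionMartingale` from its hull-time form and trace existence.** If for
every `A ∈ 𝒬*` the restriction martingale of [LSW] Prop. 5.3 exists along the hull hitting time
`T_A = inf{t : K_t ∩ A ≠ ∅}` (as printed in §5), and SLE_{8/3} is generated by a curve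
(`HasSLETrace (8/3)`, Rohde–Schramm Thm. 5.1 — an input of every consumer of the fact in the
tree), then the named fact `sle_exists_isRestrictionMartingale` (stated along the trace hitting
time) holds. [cite: LawlerSchrammWerner2003Restriction, Prop. 5.3 and proof of Thm. 6.1] -/
theorem sle_exists_isRestrictionMartingale_of_hull (hT : HasSLETrace ((8 : ℝ≥0) / 3))
    (hM : ∀ {A : Set ℂ}, IsStarHull A → ∃ Y, IsHullRestrictionMartingale A Y) :
    sle_exists_isRestrictionMartingale := fun hA ↦
  (hM hA).imp fun _ hY ↦
    hY.isRestrictionMartingale hT hA.isBoundedHull.isClosed hA.zero_notMem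

end Literature.Probability.RandomPlanarGeometry

end
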